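import Literature.NumberTheory.LFunctions.ZetaMulSieveDensity
import Literature.NumberTheory.LFunctions.RealCharacterDivisorSumsLevel
import Literature.NumberTheory.Sieve.SelbergSumLowerBound
import Literature.NumberTheory.Sieve.SieveFrameworkProofs
import HarnessLib

/-!
# Selberg's sieve applied to `ζ ⋆ χ`: `∑_{n ≤ N, (n, P(w)) = 1} r(n) ≤ N L(1,χ)/G(w) + R`

Topic `Literature/NumberTheory/Sieve`. Everything in this file is PROVED.

For a quadratic character `χ ≠ 1` mod `q` we sift the non-negative multiplicative sequence
`r(n) = (ζ ⋆ χ)(n) = ∑_{e ∣ n} χ(e)` (`ZetaMul.coeff χ = RealChar.charDivisorSum χ`), `1 ≤ n ≤ N`, by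
the primes `p ≤ w`, with Selberg's `Λ²` sieve of level `D = w²` (the tree's
`SelbergSieve.siftedSum_le_totalMass_div_selbergSum_add`). The sieve data:

* `X = N L(1, χ)` and the multiplicative density `ν = ZetaMul.dens χ` (`ZetaMulSieveDensity.lean`),
  which agrees on squarefree `d` with the tree's `RealChar.charDivisorDensity χ`
  (`dens_eq_charDivisorDensity`);
* the remainders: the tree's Type-I estimate `RealChar.abs_congrSum_charDivisorSum_sub_le`
  (`RealCharacterDivisorSumsLevel.lean`) gives `|R_d| ≤ τ(d)² · 5q √(N/d)` for squarefree `d`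
  (`abs_rem_le`);
* the denominator: `G(w) ≥ ∑_{n ≤ w} r(n)/n` (`SelbergSumLowerBound.lean` with the local factors
  `ZetaMul.sum_coeff_prime_pow_div_le`).

Result (`sifted_le`): for `1 ≤ w`,

  `∑_{n ≤ N, (n, P) = 1} r(n) ≤ N L(1,χ) / (∑_{n ≤ w} r(n)/n) + ∑_{d ≤ w², d squarefree} 3^{ω(d)} τ(d)² · 5q√(N/d)`,

where `P = ∏_{p ≤ w} p`. This is step (3) (the sieve side) of Motohashi's proof of his theorem on
the Brun–Titchmarsh constant and Siegel zeros (`Literature/Barriers/Parity/BrunTitchmarshSiegelZero.lean`),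
for the `δ = 0` member `r = ζ ⋆ χ` of his family `B(n) = ∑_{d ∣ n} χ(d) d^{-δ}`.

## References

* Y. Motohashi, *A note on Siegel's zeros*, Proc. Japan Acad. 55A (1979) 190–192, proof of the
  Theorem ("apply the Selberg sieve to the sequence `{B(n)}`", (3)). [cite: Motohashi1979SiegelZeros, proof of the Theorem, (3)]
* H. Halberstam, H.-E. Richert, *Sieve Methods* (1974), Thm. 3.2 (Selberg's upper bound).
  [cite: HalberstamRichert1974, Thm. 3.2]
-/

noncomputable section

open Finset
open scoped ArithmeticFunction.omega

namespace Literature.NumberTheory.Sieve.ZetaMulSieve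

open Literature.NumberTheory.LFunctions.ZetaMul Literature.NumberTheory.LFunctions
  Literature.NumberTheory.LFunctions.DirichletAbel

variable {q : ℕ} (χ : DirichletCharacter ℂ q)

/-! ### The density and the remainders, from the tree's Type-I estimate -/

/-- **The two densities agree on squarefree `d`**: `ZetaMul.dens χ d = RealChar.charDivisorDensity χ d`
(both multiplicative, with the same value `(1 + χ(p)(1 − 1/p))/p = ((1 + χ(p)) − χ(p)/p)/p` at primes).
[folklore] -/
theorem dens_eq_charDivisorDensity (hq : χ ^ 2 = 1) {d : ℕ} (hd : Squarefree d) :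
    dens χ d = RealChar.charDivisorDensity χ d := by
  rw [← (isMultiplicative_dens χ).prod_primeFactors hd,
    ← (RealChar.isMultiplicative_charDivisorDensity χ hq).prod_primeFactors hd]
  refine Finset.prod_congr rfl fun p hp => ?_
  have hpp : p.Prime := Nat.prime_of_mem_primeFactors hp
  have hp0 : (p : ℝ) ≠ 0 := by exact_mod_cast hpp.ne_zero
  rw [dens_apply_prime χ hpp, RealChar.charDivisorDensity_prime χ hq hpp, densAt]
  field_simp
  ring

/-- **The remainders of the sieve** (the tree's `RealChar.abs_congrSum_charDivisorSum_sub_le` at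
`x = N`, through the bridges `coeff = charDivisorSum`, `dens = charDivisorDensity`): for squarefree `d`,
`|∑_{n ≤ N, d ∣ n} r(n) − ν(d) N L(1,χ)| ≤ τ(d)² · 5q √(N/d)`. [cite: HalberstamRichert1974, Ch. 1] -/
theorem abs_rem_le [NeZero q] (hχ : χ ≠ 1) (hq : χ ^ 2 = 1) {d : ℕ} (hd : Squarefree d) (N : ℕ) :
    |∑ n ∈ Ioc 0 N, (if d ∣ n then coeff χ n else 0) - dens χ d * (N * LOne χ)| ≤
      ((d.divisors.card : ℝ)) ^ 2 * (5 * q * Real.sqrt ((N : ℝ) / d)) := by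
  classical
  rcases Nat.eq_zero_or_pos N with rfl | hN
  · simp
  have hx : (0 : ℝ) < N := by exact_mod_cast hN
  have h := RealChar.abs_congrSum_charDivisorSum_sub_le χ hχ hq hd hx
  rw [Nat.floor_natCast, Finset.sum_filter] at h
  have hsum : ∑ n ∈ Ioc 0 N, (if d ∣ n then coeff χ n else 0) =
      ∑ n ∈ Ioc 0 N, (if d ∣ n then RealChar.charDivisorSum χ n else 0) :=
    Finset.sum_congr rfl fun n _ => by rw [coeff_eq_charDivisorSum]
  have hmain : dens χ d * (N * LOne χ) =
      RealChar.charDivisorDensity χ d * ((χ.LFunction 1).re * N) := by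
    rw [dens_eq_charDivisorDensity χ hq hd, LOne]; ring
  rw [hsum, hmain]
  refine h.trans (le_of_eq ?_)
  rw [Real.sqrt_div' _ (Nat.cast_nonneg d)]
  ring

/-! ### The sieve -/

/-- The Selberg sieve problem for `r = ζ ⋆ χ` on `1 ≤ n ≤ N`, sifting by the primes `p ≤ w`
(`P = primesProdBelow (w+1)`), level `D = w²`, `X = N L(1,χ)`, density `ν = dens χ`.
[cite: Motohashi1979SiegelZeros, proof of the Theorem, (3)] -/
def sieve [NeZero q] (hq : χ ^ 2 = 1) (N w : ℕ) (hw : 1 ≤ w) : SelbergSieve where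
  support := Ioc 0 N
  prodPrimes := primesProdBelow ((w : ℝ) + 1)
  prodPrimes_squarefree := squarefree_primesProdBelow _
  weights := coeff χ
  weights_nonneg := coeff_nonneg χ hq
  totalMass := N * LOne χ
  nu := dens χ
  nu_mult := isMultiplicative_dens χ
  nu_pos_of_prime p hp _ := by rw [dens_apply_prime χ hp]; exact densAt_pos χ hq hp
  nu_lt_one_of_prime p hp _ := by rw [dens_apply_prime χ hp]; exact densAt_lt_one χ hq hp
  level := (w : ℝ) ^ 2
  one_le_level := by
    have : (1 : ℝ) ≤ w := by exact_mod_cast hw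
    nlinarith

omit χ in
/-- A prime divides `primesProdBelow (w+1)` iff `p ≤ w`. [folklore] -/
theorem prime_dvd_primesProdBelow_iff {p w : ℕ} (hp : p.Prime) :
    p ∣ primesProdBelow ((w : ℝ) + 1) ↔ p ≤ w := by
  rw [dvd_primesProdBelow_iff hp]
  constructor
  · intro h; exact_mod_cast Nat.lt_succ_iff.mp (by exact_mod_cast h : p < w + 1)
  · intro h; exact_mod_cast Nat.lt_succ_of_le h

/-- **Selberg's sieve for `ζ ⋆ χ`.** For a quadratic `χ ≠ 1` mod `q`, `N`, and `w ≥ 1`: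
`∑_{n ≤ N, (n, P) = 1} r(n) ≤ N L(1,χ) / (∑_{n ≤ w} r(n)/n) + ∑_{d ≤ w², d squarefree} 3^{ω(d)} τ(d)² · 5q√(N/d)`,
`P = ∏_{p ≤ w} p` (Selberg's `Λ²` bound with level `w²`, the denominator bounded below by the
radical expansion, the remainders by `abs_rem_le`).
[cite: Motohashi1979SiegelZeros, proof of the Theorem, (3)] [cite: HalberstamRichert1974, Thm. 3.2] -/
theorem sifted_le [NeZero q] (hχ : χ ≠ 1) (hq : χ ^ 2 = 1) (N : ℕ) {w : ℕ} (hw : 1 ≤ w) :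
    ∑ n ∈ (Ioc 0 N).filter (fun n : ℕ => n.Coprime (primesProdBelow ((w : ℝ) + 1))), coeff χ n ≤
      N * LOne χ / (∑ n ∈ Ioc 0 w, coeff χ n / n) +
        ∑ d ∈ (Ioc 0 (w ^ 2)).filter Squarefree,
          (3 : ℝ) ^ ω d * (((d.divisors.card : ℝ)) ^ 2 * (5 * q * Real.sqrt ((N : ℝ) / d))) := by
  classical
  set S := sieve χ hq N w hw with hS
  have hmain := SelbergSieve.siftedSum_le_totalMass_div_selbergSum_add_holds S
  -- identify the sifted sum
  have hsift : S.siftedSum =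
      ∑ n ∈ (Ioc 0 N).filter (fun n : ℕ => n.Coprime (primesProdBelow ((w : ℝ) + 1))), coeff χ n := by
    rw [BoundingSieve.siftedSum, Finset.sum_filter]
    refine Finset.sum_congr rfl fun n _ => ?_
    simp only [hS, sieve, Nat.coprime_comm]
  -- the denominator: `G(w) ≥ ∑_{n ≤ w} r(n)/n` (radical expansion with `K = w`)
  have hG : ∑ n ∈ Ioc 0 w, coeff χ n / n ≤ S.selbergSum := by
    have hf : ((coeffAF χ).pmul ⟨fun n => (n : ℝ)⁻¹, by simp⟩).IsMultiplicative :=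
      (isMultiplicative_coeffAF χ hq).pmul ⟨by simp, fun {m n} _ => by simp [mul_comm]⟩
    have hf0 : ∀ n, 0 ≤ ((coeffAF χ).pmul ⟨fun n => (n : ℝ)⁻¹, by simp⟩) n := fun n => by
      simp only [ArithmeticFunction.pmul_apply, coeffAF_apply, ArithmeticFunction.coe_mk]
      exact mul_nonneg (coeff_nonneg χ hq n) (inv_nonneg.mpr (Nat.cast_nonneg n))
    have hwK : w < 2 ^ (w + 1) :=
      Nat.lt_two_pow_self.trans (Nat.pow_lt_pow_right (by norm_num) (Nat.lt_succ_self w))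
    have h := SelbergSieve.sum_le_selbergSum_of_multiplicative S hf hf0 hwK
      (le_of_eq (by simp [hS, sieve]))
      (fun p hp hpw => (prime_dvd_primesProdBelow_iff hp).mpr hpw) ?_
    · refine le_trans (le_of_eq (Finset.sum_congr rfl fun n _ => ?_)) h
      simp [ArithmeticFunction.pmul_apply, div_eq_mul_inv]
    · intro p hp hpw
      have hsel : S.selbergTerms p = densAt χ p / (1 - densAt χ p) := by
        rw [BoundingSieve.selbergTerms_apply, hp.primeFactors, Finset.prod_singleton]
        simp only [hS, sieve, dens_apply_prime χ hp, div_eq_mul_inv]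
      rw [hsel]
      refine le_trans (le_of_eq (Finset.sum_congr rfl fun k _ => ?_))
        (sum_coeff_prime_pow_div_le χ hq hp w)
      simp [ArithmeticFunction.pmul_apply, div_eq_mul_inv]
  have hGpos : 0 < ∑ n ∈ Ioc 0 w, coeff χ n / n := by
    refine lt_of_lt_of_le zero_lt_one ?_
    have h1 : (1 : ℝ) = coeff χ 1 / (1 : ℕ) := by simp
    rw [h1]
    refine Finset.single_le_sum (fun n _ => div_nonneg (coeff_nonneg χ hq n) (Nat.cast_nonneg n)) ?_
    simp [hw]
  have hX : 0 ≤ (N : ℝ) * LOne χ := mul_nonneg (Nat.cast_nonneg N) (LOne_pos χ hχ hq).le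
  have hdiv : S.totalMass / S.selbergSum ≤ N * LOne χ / (∑ n ∈ Ioc 0 w, coeff χ n / n) := by
    simp only [hS, sieve] at hG ⊢
    exact div_le_div_of_nonneg_left hX hGpos hG
  -- the error term
  have herr : ∑ d ∈ S.prodPrimes.divisors.filter (fun d : ℕ => (d : ℝ) ≤ S.level),
      (3 : ℝ) ^ ω d * |S.rem d| ≤
      ∑ d ∈ (Ioc 0 (w ^ 2)).filter Squarefree,
        (3 : ℝ) ^ ω d * (((d.divisors.card : ℝ)) ^ 2 * (5 * q * Real.sqrt ((N : ℝ) / d))) := by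
    have hsub : S.prodPrimes.divisors.filter (fun d : ℕ => (d : ℝ) ≤ S.level) ⊆
        (Ioc 0 (w ^ 2)).filter Squarefree := by
      intro d hd
      rw [Finset.mem_filter, Nat.mem_divisors] at hd
      rw [Finset.mem_filter, Finset.mem_Ioc]
      have hdP := hd.1.1
      refine ⟨⟨Nat.pos_of_dvd_of_pos hdP (Nat.pos_of_ne_zero hd.1.2), ?_⟩,
        S.prodPrimes_squarefree.squarefree_of_dvd hdP⟩
      have : (d : ℝ) ≤ (w : ℝ) ^ 2 := by simpa [hS, sieve] using hd.2
      exact_mod_cast this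
    refine le_trans ?_ (Finset.sum_le_sum_of_subset_of_nonneg hsub fun d _ _ => by positivity)
    refine Finset.sum_le_sum fun d hd => ?_
    rw [Finset.mem_filter, Nat.mem_divisors] at hd
    have hdsq : Squarefree d := S.prodPrimes_squarefree.squarefree_of_dvd hd.1.1
    refine mul_le_mul_of_nonneg_left ?_ (by positivity)
    have hrem : S.rem d = ∑ n ∈ Ioc 0 N, (if d ∣ n then coeff χ n else 0) - dens χ d * (N * LOne χ) := by
      simp [BoundingSieve.rem, BoundingSieve.multSum, hS, sieve]
    rw [hrem]
    exact abs_rem_le χ hχ hq hdsq N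
  rw [hsift] at hmain
  exact hmain.trans (add_le_add hdiv herr)

end Literature.NumberTheory.Sieve.ZetaMulSieve

end
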